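import Mathlib.Probability.Kernel.MeasurableLIntegral
import Mathlib.MeasureTheory.Function.AEEqOfLIntegral
import Mathlib.MeasureTheory.Measure.WithDensity
import Literature.Probability.LatticeModels.GibbsSpecificationDLRProofs
import HarnessLib

/-!
# Densities between DLR measures of a specification (Georgii 2011, §7.1)

Topic `Probability/LatticeModels`, namespace `Literature.Probability.LatticeModels`. Theorem-only file
(no definitions, no named facts) on the measure theory of the DLR equations of a specification `γ`
(`IsSpecification`, `GibbsSpecification.lean`), written for measures `ν` that satisfy the DLR
equations `∫ γ_Λ(A | η) ν(dη) = ν(A)` without being normalised (finite "DLR measures": sums,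
positive multiples and dominated pieces of Gibbs measures occur when a Gibbs measure is decomposed).

* `IsSpecification.dlr_bind_eq`, `IsSpecification.lintegral_lintegral_eq_of_dlr` — the DLR
  equations in monadic form `ν γ_Λ = ν` and for nonnegative measurable functions,
  `∫ (∫ F dγ_Λ(·|η)) ν(dη) = ∫ F dν` (Georgii 2011, Remark 1.24; Friedli–Velenik 2017, eq. (6.20)
  and Exercise 6.6).
* `IsSpecification.ae_eq_apply_of_measurable`, `IsSpecification.lintegral_mul_left_eq` — properness
  for `𝓕_{Λᶜ}`-measurable functions: `φ = φ(η)` `γ_Λ(·|η)`-a.s., hence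
  `γ_Λ(φ F | η) = φ(η) γ_Λ(F | η)` (Georgii 2011, Remark 1.20; Friedli–Velenik 2017, Lemma 6.13,
  eq. (6.22)).
* `IsSpecification.density_ae_eq_lintegral` — **the density of a DLR measure with respect to
  another is a.s. equal to its `γ_Λ`-average, for every `Λ`** (so it is measurable with respect to
  the completed outside σ-algebra `𝓕_{Λᶜ}` for every `Λ`, i.e. almost surely tail measurable): if
  `μ = g · ρ` with `μ`, `ρ` DLR measures and `ρ` finite, then `g = γ_Λ g` `ρ`-a.s. This is the
  content of Georgii 2011, Thm. 7.7 (a)/(b) direction "`μ ≪ ν` on `𝒢(γ)` ⇒ the density is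
  `𝒯`-measurable" (proof of (7.8) there), proved here directly from the DLR equations and
  properness: both `g · ρ` and `(γ_Λ g) · ρ` satisfy `A ↦ ∫ γ_Λ(A|η) g(η) ρ(dη)`.
* `IsSpecification.dlr_withDensity` — conversely, **multiplying a DLR measure by an a.s.
  `𝓕_{Λᶜ}`-measurable density (for every `Λ`) gives a DLR measure** (Georgii 2011, Thm. 7.7 /
  Remark 7.2: `h · μ ∈ 𝒢(γ)` for `𝒯`-measurable `h ≥ 0` with `μ(h) = 1`), and the combination
  `IsSpecification.dlr_withDensity_of_absolutelyContinuous`: the density of `μ` w.r.t. `ρ` may be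
  transported to any DLR measure `ρ' ≪ ρ`.

These are the measure-theoretic inputs of the decomposition of a zero-field Ising Gibbs measure
with the even correlations of `μ⁺` into a mixture of `μ⁺` and `μ⁻` (`IsingGibbsMixture.lean`).

## Mathlib status

Mathlib has kernels, `Measure.bind`, `Measure.withDensity`, but no specifications / DLR measures.
Anchors: `Measure.lintegral_bind`, `Measurable.lintegral_kernel`,
`lintegral_withDensity_eq_lintegral_mul`, `withDensity_apply`, `withDensity_eq_iff_of_sigmaFinite`,
`setLIntegral_congr_fun_ae`, `Measure.AbsolutelyContinuous.ae_eq`; tree: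
`IsSpecification.measurable_fun/measurable_coe/ae_mem_iff_mem/toKernel`
(`GibbsSpecificationDLRProofs.lean`, `GibbsSpecification.lean`).

## References

* H.-O. Georgii, *Gibbs Measures and Phase Transitions*, 2nd ed., de Gruyter (2011), §1.2–1.3
  (Remark 1.20, Def. 1.23, Remark 1.24), §7.1 (Remark 7.2, Thm. 7.7).
* S. Friedli, Y. Velenik, *Statistical Mechanics of Lattice Systems*, CUP (2017), §6.3.1
  (Lemma 6.13, eqs. (6.20), (6.22)), Exercise 6.6, §6.8.
-/

noncomputable section

open MeasureTheory ProbabilityTheory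
open scoped ENNReal

namespace Literature.Probability.LatticeModels

variable {V S : Type*} [MeasurableSpace S] {γ : Specification V S}

namespace IsSpecification

/-! ### The DLR equations of a (not necessarily normalised) measure, for functions -/

/-- **DLR equations in monadic form** for a measure `ν` with `∫ γ_Λ(A|η) ν(dη) = ν(A)`:
`ν.bind (γ Λ) = ν` (Georgii 2011, Remark 1.24; Friedli–Velenik 2017, eq. (6.20)); the proof of
`IsGibbsMeasure.bind_eq` verbatim, without the normalisation. [cite: Georgii2011, Rem. 1.24] -/
theorem dlr_bind_eq (hγ : IsSpecification γ) {ν : Measure (V → S)}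
    (hν : ∀ (Λ : Finset V) (A : Set (V → S)), MeasurableSet A → ∫⁻ η, γ Λ η A ∂ν = ν A)
    (Λ : Finset V) : ν.bind (γ Λ) = ν := by
  ext A hA
  rw [Measure.bind_apply hA (hγ.measurable_fun Λ).aemeasurable]
  exact hν Λ A hA

/-- **DLR equations for nonnegative measurable functions**: if `∫ γ_Λ(A|η) ν(dη) = ν(A)` for all
measurable `A`, then `∫ (∫ F dγ_Λ(·|η)) ν(dη) = ∫ F dν` for every measurable `F ≥ 0`
(Friedli–Velenik 2017, Exercise 6.6 with eq. (6.20); Georgii 2011, Remark 1.24), via Mathlib's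
`Measure.lintegral_bind`. [cite: FriedliVelenik2017, Exercise 6.6] -/
theorem lintegral_lintegral_eq_of_dlr (hγ : IsSpecification γ) {ν : Measure (V → S)}
    (hν : ∀ (Λ : Finset V) (A : Set (V → S)), MeasurableSet A → ∫⁻ η, γ Λ η A ∂ν = ν A)
    (Λ : Finset V) {F : (V → S) → ℝ≥0∞} (hF : Measurable F) :
    ∫⁻ η, ∫⁻ σ, F σ ∂(γ Λ η) ∂ν = ∫⁻ σ, F σ ∂ν := by
  calc ∫⁻ η, ∫⁻ σ, F σ ∂(γ Λ η) ∂ν = ∫⁻ σ, F σ ∂(ν.bind (γ Λ)) :=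
        (Measure.lintegral_bind (hγ.measurable_fun Λ).aemeasurable hF.aemeasurable).symm
    _ = ∫⁻ σ, F σ ∂ν := by rw [hγ.dlr_bind_eq hν Λ]

/-! ### Properness for `𝓕_{Λᶜ}`-measurable functions -/

/-- **Properness for functions** (Georgii 2011, Remark 1.20; Friedli–Velenik 2017, Lemma 6.13):
an `𝓕_{Λᶜ}`-measurable function (with values in a space with measurable points) is
`γ_Λ(·|η)`-a.s. equal to its value at the boundary condition `η`. [cite: Georgii2011, Rem. 1.20] -/
theorem ae_eq_apply_of_measurable (hγ : IsSpecification γ) (Λ : Finset V) {β : Type*}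
    [MeasurableSpace β] [MeasurableSingletonClass β] {φ : (V → S) → β}
    (hφ : Measurable[cylinderEvents (X := fun _ : V => S) ((↑Λ : Set V)ᶜ)] φ) (η : V → S) :
    ∀ᵐ σ ∂(γ Λ η), φ σ = φ η := by
  have hB : MeasurableSet[cylinderEvents (X := fun _ : V => S) ((↑Λ : Set V)ᶜ)] (φ ⁻¹' {φ η}) :=
    hφ (measurableSet_singleton _)
  filter_upwards [hγ.ae_mem_iff_mem Λ hB η] with σ hσ
  exact hσ.2 rfl

/-- **`γ_Λ(φ F | η) = φ(η) γ_Λ(F | η)` for `𝓕_{Λᶜ}`-measurable `φ ≥ 0`** and measurable `F ≥ 0`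
(Friedli–Velenik 2017, Lemma 6.13, eq. (6.22), for functions; Georgii 2011, Remark 1.20). [cite: FriedliVelenik2017, Lemma 6.13] -/
theorem lintegral_mul_left_eq (hγ : IsSpecification γ) (Λ : Finset V) {φ F : (V → S) → ℝ≥0∞}
    (hφ : Measurable[cylinderEvents (X := fun _ : V => S) ((↑Λ : Set V)ᶜ)] φ) (hF : Measurable F)
    (η : V → S) : ∫⁻ σ, φ σ * F σ ∂(γ Λ η) = φ η * ∫⁻ σ, F σ ∂(γ Λ η) := by
  rw [← lintegral_const_mul _ hF]
  refine lintegral_congr_ae ?_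
  filter_upwards [hγ.ae_eq_apply_of_measurable Λ hφ η] with σ hσ
  rw [hσ]

/-- **DLR with an `𝓕_{Λᶜ}`-measurable weight**: for a DLR measure `ν`, an `𝓕_{Λᶜ}`-measurable
`φ ≥ 0` and a measurable `F ≥ 0`, `∫ φ(η) γ_Λ(F|η) ν(dη) = ∫ φ F dν` (Georgii 2011, Remark 1.20 with
Remark 1.24; Friedli–Velenik 2017, proof of Lemma 6.13 / eq. (6.23)). [cite: Georgii2011, Rem. 1.20 and Rem. 1.24] -/
theorem lintegral_mul_lintegral_eq_of_dlr (hγ : IsSpecification γ) {ν : Measure (V → S)}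
    (hν : ∀ (Λ : Finset V) (A : Set (V → S)), MeasurableSet A → ∫⁻ η, γ Λ η A ∂ν = ν A)
    (Λ : Finset V) {φ F : (V → S) → ℝ≥0∞}
    (hφ : Measurable[cylinderEvents (X := fun _ : V => S) ((↑Λ : Set V)ᶜ)] φ) (hF : Measurable F) :
    ∫⁻ η, φ η * ∫⁻ σ, F σ ∂(γ Λ η) ∂ν = ∫⁻ σ, φ σ * F σ ∂ν := by
  have hφ' : Measurable φ := hφ.mono cylinderEvents_le_pi le_rfl
  calc ∫⁻ η, φ η * ∫⁻ σ, F σ ∂(γ Λ η) ∂ν = ∫⁻ η, ∫⁻ σ, φ σ * F σ ∂(γ Λ η) ∂ν :=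
        lintegral_congr fun η => (hγ.lintegral_mul_left_eq Λ hφ hF η).symm
    _ = ∫⁻ σ, φ σ * F σ ∂ν := hγ.lintegral_lintegral_eq_of_dlr hν Λ (hφ'.mul hF)

/-- Special case `F = 1_A`: `∫ φ(η) γ_Λ(A|η) ν(dη) = ∫_A φ dν` for `𝓕_{Λᶜ}`-measurable `φ ≥ 0`
(Georgii 2011, Remark 1.20 with Remark 1.24). [cite: Georgii2011, Rem. 1.20 and Rem. 1.24] -/
theorem lintegral_mul_apply_eq_setLIntegral_of_dlr (hγ : IsSpecification γ) {ν : Measure (V → S)}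
    (hν : ∀ (Λ : Finset V) (A : Set (V → S)), MeasurableSet A → ∫⁻ η, γ Λ η A ∂ν = ν A)
    (Λ : Finset V) {φ : (V → S) → ℝ≥0∞}
    (hφ : Measurable[cylinderEvents (X := fun _ : V => S) ((↑Λ : Set V)ᶜ)] φ)
    {A : Set (V → S)} (hA : MeasurableSet A) :
    ∫⁻ η, φ η * γ Λ η A ∂ν = ∫⁻ σ in A, φ σ ∂ν := by
  have h1 : ∀ η, γ Λ η A = ∫⁻ σ, A.indicator 1 σ ∂(γ Λ η) := fun η =>
    (lintegral_indicator_one hA).symm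
  have h2 : (fun σ => φ σ * A.indicator 1 σ) = A.indicator φ := by
    funext σ
    by_cases hσ : σ ∈ A
    · rw [Set.indicator_of_mem hσ, Set.indicator_of_mem hσ, Pi.one_apply, mul_one]
    · rw [Set.indicator_of_notMem hσ, Set.indicator_of_notMem hσ, mul_zero]
  simp_rw [h1]
  rw [hγ.lintegral_mul_lintegral_eq_of_dlr hν Λ hφ (measurable_one.indicator hA), h2,
    lintegral_indicator hA]

/-! ### The `γ_Λ`-average of a density -/

/-- The `γ_Λ`-average `η ↦ γ_Λ(g | η)` of a measurable `g ≥ 0` is `𝓕_{Λᶜ}`-measurable (the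
measurability axiom of a specification, Georgii 2011, Def. 1.23 (ii), through Mathlib's
`Measurable.lintegral_kernel` for `IsSpecification.toKernel`). [cite: Georgii2011, Def. 1.23] -/
theorem measurable_cylinderEvents_lintegral (hγ : IsSpecification γ) (Λ : Finset V)
    {g : (V → S) → ℝ≥0∞} (hg : Measurable g) :
    Measurable[cylinderEvents (X := fun _ : V => S) ((↑Λ : Set V)ᶜ)]
      fun η => ∫⁻ σ, g σ ∂(γ Λ η) :=
  Measurable.lintegral_kernel (κ := hγ.toKernel Λ) hg

/-- **The density of a DLR measure with respect to a DLR measure equals its `γ_Λ`-average almost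
surely, for every `Λ`** (Georgii 2011, Thm. 7.7 and its proof, eq. (7.8): densities within `𝒢(γ)`
are `𝒯`-measurable; here in the a.s. form, for finite DLR measures): if `μ = g · ρ` where `μ` and
`ρ` both satisfy the DLR equations for `γ` and `ρ` is finite, then `g = γ_Λ g` `ρ`-a.s. Proof: for
measurable `A`, `μ(A) = ∫ γ_Λ(A|η) μ(dη) = ∫ γ_Λ(A|η) g(η) ρ(dη) = ∫ γ_Λ(A|η) (γ_Λ g)(η) ρ(dη)`
(DLR for `ρ` with the `𝓕_{Λᶜ}`-measurable weight `γ_Λ(A|·)`, and properness), and the last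
expression is `((γ_Λ g) · ρ)(A)` (DLR for `ρ` with the weight `γ_Λ g`); so `g · ρ = (γ_Λ g) · ρ`. [cite: Georgii2011, Thm. 7.7] -/
theorem density_ae_eq_lintegral (hγ : IsSpecification γ) {μ ρ : Measure (V → S)}
    [IsFiniteMeasure ρ]
    (hμ : ∀ (Λ : Finset V) (A : Set (V → S)), MeasurableSet A → ∫⁻ η, γ Λ η A ∂μ = μ A)
    (hρ : ∀ (Λ : Finset V) (A : Set (V → S)), MeasurableSet A → ∫⁻ η, γ Λ η A ∂ρ = ρ A)
    {g : (V → S) → ℝ≥0∞} (hg : Measurable g) (hμρ : μ = ρ.withDensity g) (Λ : Finset V) :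
    g =ᵐ[ρ] fun η => ∫⁻ σ, g σ ∂(γ Λ η) := by
  have hgΛm := hγ.measurable_cylinderEvents_lintegral Λ hg
  have hgΛ : Measurable fun η => ∫⁻ σ, g σ ∂(γ Λ η) := hgΛm.mono cylinderEvents_le_pi le_rfl
  have key : ρ.withDensity g = ρ.withDensity fun η => ∫⁻ σ, g σ ∂(γ Λ η) := by
    ext A hA
    have hφ : Measurable[cylinderEvents (X := fun _ : V => S) ((↑Λ : Set V)ᶜ)] fun η => γ Λ η A :=
      hγ.measurable Λ A hA
    rw [← hμρ, withDensity_apply _ hA]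
    calc μ A = ∫⁻ η, γ Λ η A ∂μ := (hμ Λ A hA).symm
      _ = ∫⁻ η, (g * fun η => γ Λ η A) η ∂ρ := by
          rw [hμρ, lintegral_withDensity_eq_lintegral_mul _ hg (hγ.measurable_coe Λ hA)]
      _ = ∫⁻ η, γ Λ η A * g η ∂ρ := lintegral_congr fun η => by rw [Pi.mul_apply, mul_comm]
      _ = ∫⁻ η, γ Λ η A * ∫⁻ σ, g σ ∂(γ Λ η) ∂ρ :=
          (hγ.lintegral_mul_lintegral_eq_of_dlr hρ Λ hφ hg).symm
      _ = ∫⁻ η, (∫⁻ σ, g σ ∂(γ Λ η)) * γ Λ η A ∂ρ := lintegral_congr fun η => mul_comm _ _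
      _ = ∫⁻ σ in A, (fun η => ∫⁻ σ, g σ ∂(γ Λ η)) σ ∂ρ :=
          hγ.lintegral_mul_apply_eq_setLIntegral_of_dlr hρ Λ hgΛm hA
  exact (withDensity_eq_iff_of_sigmaFinite hg.aemeasurable hgΛ.aemeasurable).1 key

/-- Hence such a density is, for every `Λ`, `ρ`-a.s. equal to an `𝓕_{Λᶜ}`-measurable function
(Georgii 2011, Thm. 7.7: "almost surely tail measurable"). [cite: Georgii2011, Thm. 7.7] -/
theorem exists_measurable_cylinderEvents_ae_eq_density (hγ : IsSpecification γ)
    {μ ρ : Measure (V → S)} [IsFiniteMeasure ρ]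
    (hμ : ∀ (Λ : Finset V) (A : Set (V → S)), MeasurableSet A → ∫⁻ η, γ Λ η A ∂μ = μ A)
    (hρ : ∀ (Λ : Finset V) (A : Set (V → S)), MeasurableSet A → ∫⁻ η, γ Λ η A ∂ρ = ρ A)
    {g : (V → S) → ℝ≥0∞} (hg : Measurable g) (hμρ : μ = ρ.withDensity g) (Λ : Finset V) :
    ∃ gΛ : (V → S) → ℝ≥0∞,
      Measurable[cylinderEvents (X := fun _ : V => S) ((↑Λ : Set V)ᶜ)] gΛ ∧ g =ᵐ[ρ] gΛ :=
  ⟨fun η => ∫⁻ σ, g σ ∂(γ Λ η), hγ.measurable_cylinderEvents_lintegral Λ hg,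
    hγ.density_ae_eq_lintegral hμ hρ hg hμρ Λ⟩

/-! ### Multiplying a DLR measure by an almost surely tail-measurable density -/

/-- **`g · ρ` is a DLR measure when `ρ` is and `g` is a.s. `𝓕_{Λᶜ}`-measurable for every `Λ`**
(Georgii 2011, Remark 7.2 / Thm. 7.7: `h μ ∈ 𝒢(γ)` for `𝒯`-measurable densities `h`):
`∫ γ_Λ(A|η) g(η) ρ(dη) = ∫ γ_Λ(A|η) g_Λ(η) ρ(dη) = ∫_A g_Λ dρ = ∫_A g dρ`. [cite: Georgii2011, Rem. 7.2 and Thm. 7.7] -/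
theorem dlr_withDensity (hγ : IsSpecification γ) {ρ : Measure (V → S)}
    (hρ : ∀ (Λ : Finset V) (A : Set (V → S)), MeasurableSet A → ∫⁻ η, γ Λ η A ∂ρ = ρ A)
    {g : (V → S) → ℝ≥0∞} (hg : Measurable g)
    (htail : ∀ Λ : Finset V, ∃ gΛ : (V → S) → ℝ≥0∞,
      Measurable[cylinderEvents (X := fun _ : V => S) ((↑Λ : Set V)ᶜ)] gΛ ∧ g =ᵐ[ρ] gΛ) :
    ∀ (Λ : Finset V) (A : Set (V → S)), MeasurableSet A →
      ∫⁻ η, γ Λ η A ∂(ρ.withDensity g) = ρ.withDensity g A := by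
  intro Λ A hA
  obtain ⟨gΛ, hgΛm, hae⟩ := htail Λ
  calc ∫⁻ η, γ Λ η A ∂(ρ.withDensity g) = ∫⁻ η, (g * fun η => γ Λ η A) η ∂ρ :=
        lintegral_withDensity_eq_lintegral_mul _ hg (hγ.measurable_coe Λ hA)
    _ = ∫⁻ η, gΛ η * γ Λ η A ∂ρ := by
        refine lintegral_congr_ae ?_
        filter_upwards [hae] with η hη
        rw [Pi.mul_apply, hη]
    _ = ∫⁻ σ in A, gΛ σ ∂ρ := hγ.lintegral_mul_apply_eq_setLIntegral_of_dlr hρ Λ hgΛm hA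
    _ = ∫⁻ σ in A, g σ ∂ρ := by
        refine setLIntegral_congr_fun_ae hA ?_
        filter_upwards [hae] with σ hσ _
        rw [hσ]
    _ = ρ.withDensity g A := (withDensity_apply g hA).symm

/-- **Transport of a density between DLR measures.** If `μ = g · ρ` with `μ`, `ρ` finite DLR
measures and `ρ'` is a DLR measure with `ρ' ≪ ρ`, then `g · ρ'` is a DLR measure: by
`density_ae_eq_lintegral`, `g` is `ρ`-a.s., hence `ρ'`-a.s., equal to its `𝓕_{Λᶜ}`-measurable
`γ_Λ`-average for every `Λ`, and `dlr_withDensity` applies (Georgii 2011, Thm. 7.7 (a), (b)). This is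
the step "each piece of a Gibbs measure dominated by `μ⁺ + μ⁻` is again Gibbs" of the decomposition
of zero-field Ising states. [cite: Georgii2011, Thm. 7.7] -/
theorem dlr_withDensity_of_absolutelyContinuous (hγ : IsSpecification γ)
    {μ ρ ρ' : Measure (V → S)} [IsFiniteMeasure ρ]
    (hμ : ∀ (Λ : Finset V) (A : Set (V → S)), MeasurableSet A → ∫⁻ η, γ Λ η A ∂μ = μ A)
    (hρ : ∀ (Λ : Finset V) (A : Set (V → S)), MeasurableSet A → ∫⁻ η, γ Λ η A ∂ρ = ρ A)
    (hρ' : ∀ (Λ : Finset V) (A : Set (V → S)), MeasurableSet A → ∫⁻ η, γ Λ η A ∂ρ' = ρ' A)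
    (hac : ρ' ≪ ρ) {g : (V → S) → ℝ≥0∞} (hg : Measurable g) (hμρ : μ = ρ.withDensity g) :
    ∀ (Λ : Finset V) (A : Set (V → S)), MeasurableSet A →
      ∫⁻ η, γ Λ η A ∂(ρ'.withDensity g) = ρ'.withDensity g A :=
  hγ.dlr_withDensity hρ' hg fun Λ =>
    ⟨fun η => ∫⁻ σ, g σ ∂(γ Λ η), hγ.measurable_cylinderEvents_lintegral Λ hg,
      hac.ae_eq (hγ.density_ae_eq_lintegral hμ hρ hg hμρ Λ)⟩

end IsSpecification

end Literature.Probability.LatticeModels
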